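import Literature.Claims.NS.Reed2026
import HarnessLib

/-!
# C124 `Reed2026` — kernel fact for the NS-claims sweep (D-0090), refuter-8

Typed record: `Literature.Claims.NS.Reed2026` (typist-11 g2, p481508), D. Reed, Zenodo 21926631
(`NavierStokes.lean` + text): the headline «the set of smooth solutions is the empty set: S = ∅» (§6 p.18;
abstract p.1), typed AT THE PAPER'S OWN GRAIN as `ClaimedTheorem` — no time-independent field satisfying
the deposit's steady `FullNavierStokesPDE` (some pressure, some `ν`) with the no-slip condition at a corner
point of a right-angle corner domain is a `GlobalSmoothSolution` (= `Differentiable ℝ u`).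

Kernel facts (sorry-free, standard axioms):

* `fullNavierStokesPDE_rest` — the fluid at rest `u ≡ 0`, `p ≡ 0` satisfies the deposit's steady system
  for every `ν` (every term is an `fderiv` of a constant);
* `not_ClaimedTheorem` — hence «S = ∅» is false at its own grain: the rest state in the octant
  `{x ≥ 0, y ≥ 0, z ≥ 0}` with corner point `(1, 0, 0)` is a smooth (differentiable) solution with no-slip;
* `not_Step_bridge` — so the printed bridge «capstone ⇒ S = ∅» (§3.5 p.9 / §6 p.18), which IS the claim
  since the capstone holds vacuously (`step_bridge_iff_claimedTheorem`), is false.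

WHAT THIS IS NOT: not a claim about NS regularity or blow-up; not a claim about any author beyond the
typed locator.
-/

set_option linter.dupNamespace false

noncomputable section

open Set Function
open Literature.Claims.NS.Reed2026

namespace Summit.NavierStokesRegularity.NavierStokesRegularity.Theorems.Reed2026

/-- The fluid at rest. -/
def rest : VectorField3D := fun _ => (0, 0, 0)

/-- Zero pressure. -/
def zeroPressure : ScalarField3D := fun _ => 0

/-- The closed first octant, a right-angle corner domain with `x0 = y0 = z0 = 0`. -/
def octant : Set Point3D := {q | q.1 ≥ 0 ∧ q.2.1 ≥ 0 ∧ q.2.2 ≥ 0}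

/-- The octant is a right-angle corner domain in the deposit's sense. [folklore] -/
theorem isRightAngleCornerDomain_octant : IsRightAngleCornerDomain octant :=
  ⟨0, 0, 0, fun _ => Iff.rfl⟩

/-- The Fréchet derivative of the rest field vanishes. [folklore] -/
@[simp] theorem fderiv_rest (q : Point3D) : fderiv ℝ rest q = 0 :=
  (hasFDerivAt_const ((0 : ℝ), (0 : ℝ), (0 : ℝ)) q).fderiv

/-- The Fréchet derivative of the zero pressure vanishes. [folklore] -/
@[simp] theorem fderiv_zeroPressure (q : Point3D) : fderiv ℝ zeroPressure q = 0 :=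
  (hasFDerivAt_const (0 : ℝ) q).fderiv

/-- The rest field vanishes everywhere. [folklore] -/
@[simp] theorem rest_apply (q : Point3D) : rest q = (0, 0, 0) := rfl

/-- **The rest state solves the deposit's steady system** (`div u = 0`, `(u·∇)u = −∇p + νΔu` with
`u ≡ 0`, `p ≡ 0`), for every `ν`. [folklore] -/
theorem fullNavierStokesPDE_rest (nu : ℝ) : FullNavierStokesPDE rest zeroPressure nu := by
  refine ⟨fun q => ?_, fun q => ?_⟩
  · simp [Divergence, VelocityGradient]
  · simp [AdvectiveTerm, PressureGradient, ViscousLaplacian, Prod.mk_zero_zero]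

/-- **«S = ∅» is false at the paper's own grain (C124).** The rest state in the first octant, with the
corner point `(1, 0, 0)`, satisfies every hypothesis of `ClaimedTheorem` and is a `GlobalSmoothSolution`
(a differentiable field; the enstrophy conjunct is automatic). Refutes
`Literature.Claims.NS.Reed2026.ClaimedTheorem` [refuted-substantive at the typed grain: the steady no-slip
corner system has the trivial smooth solution; no repair short of changing the solution notion].
[folklore] -/
theorem not_ClaimedTheorem : ¬ Literature.Claims.NS.Reed2026.ClaimedTheorem := by
  intro h
  have hS : GlobalSmoothSolution rest :=
    (globalSmoothSolution_iff rest).mpr (differentiable_const ((0 : ℝ), (0 : ℝ), (0 : ℝ)))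
  exact h octant (1, 0, 0) rest zeroPressure 1 (fullNavierStokesPDE_rest 1)
    isRightAngleCornerDomain_octant one_pos rfl hS

/-- **The printed bridge «capstone ⇒ S = ∅» (§3.5 p.9 / §6 p.18) is false (C124):** the capstone holds
(vacuously, `topTheoremType_holds`) and the headline does not. Refutes
`Literature.Claims.NS.Reed2026.Step_bridge`. [folklore] -/
theorem not_Step_bridge : ¬ Literature.Claims.NS.Reed2026.Step_bridge :=
  fun h => not_ClaimedTheorem (step_bridge_iff_claimedTheorem.mp h)

end Summit.NavierStokesRegularity.NavierStokesRegularity.Theorems.Reed2026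

end
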